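import Mathlib
import Summits.PneNP.PneNP.Theorems.ResolutionUncertainty.Negative.ShadowSeparators

/-!
# `ResolutionUncertainty` (stmt-PneNP-9816), negative side of line `jukna-game-monotone-interpolation`:
# the registered engine `ShadowLowerBound` fails on every family of partite rich splits

Support file of the deep refuter (drefute gen 3), definition-free. Stub 2 of
`Cruxes/ResolutionUncertainty/Lines/jukna-game-monotone-interpolation.lean` reads

  `ShadowLowerBound : ∀ η c ∈ (0, 1/8], ∃ ε > 0, ∃ n₀, ∀ n ≥ n₀, ∀ H A B kA kB,`
  `  RichSplit η c n H A B kA kB → ∀ monotone C separating (Alice kA-cliques ⊆ A) from`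
  `  (shadows of Bob kB-cliques ⊆ B), n ^ (ε log₂ n) ≤ C.size`.

Nothing in `RichSplit` excludes `(k-1)`-COLOURABLE graphs, and on those the partite separator
of `ShadowSeparators.lean` has polynomial size. `shadowLowerBound_false_of_partite` records
this as a kernel-checked implication for an ARBITRARY richness predicate `Rich` with the
argument order of the skeleton's `RichSplit` — the statement of stub 2 is written out with
`Rich` in place of `RichSplit` and the test vectors `posVec` / `shadowVec` unfolded, so that at
`Rich :=` the skeleton's `RichSplit` the refuted proposition is DEFINITIONALLY the registered
stub: if for some admissible `(η, c)` there are, for infinitely many `n`, `Rich`-splits whose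
graph carries a proper colouring with `m` colours, `kA ≤ m < kA + kB`, `m ≤ n`, then the engine
is false (the separator has `≤ n³ < n^{ε log₂ n}` gates).

The hypothesis for the skeleton's `RichSplit` is the probabilistic half of the gen-2 refuter's
counterexample (balanced `(k-1)`-partite `G(n, p′)`-graphs satisfy `RichSplit η c` w.h.p.;
`Cruxes/ResolutionUncertainty/DREFUTE-g2-stub_shadowLowerBound.md` §3) — a statement about
random graphs the tree cannot yet construct; it is named, together with a verbatim copy of the
vocabulary, in `PartiteRichSplits.lean`. The repair adopted by the line
(`H.CliqueFree (kA+kB) ∧ Hᶜ.CliqueFree (kA+kB)`, i.e. Ramsey splits) excludes every colourable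
model and is not touched here. [folklore]
-/

-- `Summit.PneNP.PneNP.…` repeats `PneNP` by the tree's layout (summit = problem).
set_option linter.dupNamespace false

namespace Summit.PneNP.PneNP.Theorems.ResolutionUncertainty.Negative

open Literature.Computability.Complexity

variable {n : ℕ}

/-! ## Two growth facts -/

/-- Every fixed power of `n` is eventually below `n ^ (ε log₂ n)`. [folklore] -/
theorem exists_nat_pow_lt_rpow_logb {ε : ℝ} (hε : 0 < ε) (d : ℕ) :
    ∃ N : ℕ, ∀ n : ℕ, N ≤ n → ((n : ℝ) ^ d : ℝ) < (n : ℝ) ^ (ε * Real.logb 2 n) := by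
  obtain ⟨N, hN⟩ := exists_nat_gt ((2 : ℝ) ^ ((d : ℝ) / ε))
  refine ⟨max N 2, fun n hn => ?_⟩
  have hn2 : (2 : ℝ) ≤ n := by exact_mod_cast le_of_max_le_right hn
  have hn1 : (1 : ℝ) < n := by linarith
  have hnpos : (0 : ℝ) < n := by linarith
  have hlog : (d : ℝ) / ε < Real.logb 2 n := by
    rw [Real.lt_logb_iff_rpow_lt one_lt_two hnpos]
    calc (2 : ℝ) ^ ((d : ℝ) / ε) < N := hN
      _ ≤ n := by exact_mod_cast le_of_max_le_left hn
  have hexp : (d : ℝ) < ε * Real.logb 2 n := by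
    have h := (div_lt_iff₀ hε).1 hlog
    linarith [mul_comm ε (Real.logb 2 n)]
  calc ((n : ℝ) ^ d : ℝ) = (n : ℝ) ^ (d : ℝ) := (Real.rpow_natCast _ _).symm
    _ < (n : ℝ) ^ (ε * Real.logb 2 n) := Real.rpow_lt_rpow_of_exponent_lt hn1 hexp

/-- The partite separator's gate budget is at most `n³` once `m ≤ n` and `n ≥ 4`. [folklore] -/
theorem partite_budget_le_cube {m kA : ℕ} (hmn : m ≤ n) (hn : 4 ≤ n) :
    1 + m * (n + 2 * (m - kA) + 3) ≤ n ^ 3 := by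
  have hsub : m - kA ≤ n := (Nat.sub_le _ _).trans hmn
  calc 1 + m * (n + 2 * (m - kA) + 3) ≤ 1 + n * (n + 2 * n + 3) := by gcongr
    _ ≤ n ^ 3 := by
      obtain ⟨k, rfl⟩ : ∃ k, n = k + 4 := ⟨n - 4, by omega⟩
      ring_nf
      nlinarith [Nat.zero_le k, Nat.zero_le (k * k), Nat.zero_le (k * k * k)]

/-! ## The engine fails on partite rich splits -/

/-- **`ShadowLowerBound` is false on every family of partite rich splits.** For any richness
predicate `Rich` (argument order of the skeleton's `RichSplit`) and admissible `(η, c)`: if for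
every `N` there is an `n ≥ N` and a `Rich η c`-split `(H, A, B, kA, kB)` whose graph admits a
proper colouring with `m` colours, `kA ≤ m < kA + kB`, `m ≤ n`, then stub 2 with `RichSplit`
replaced by `Rich` (written out below; at `Rich :=` the skeleton's `RichSplit` it is the
registered `ShadowLowerBound` by `Iff.rfl`) is FALSE — the partite separator
(`exists_partite_separator`) has `≤ n³ < n^{ε log₂ n}` gates. The gen-2 refuter's balanced
`(k-1)`-partite `G(n, p′)` family is the intended (probabilistic, not formalised) witness of
the hypothesis for the skeleton's `RichSplit`. [folklore] -/
theorem shadowLowerBound_false_of_partite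
    (Rich : ∀ (_η _c : ℝ) (n : ℕ) (H : SimpleGraph (Fin n)) [DecidableRel H.Adj],
      Finset (Fin n) → Finset (Fin n) → ℕ → ℕ → Prop)
    {η c : ℝ} (hη : 0 < η) (hη' : η ≤ 1 / 8) (hc : 0 < c) (hc' : c ≤ 1 / 8)
    (hex : ∀ N : ℕ, ∃ n ≥ N, ∃ (H : SimpleGraph (Fin n)) (_ : DecidableRel H.Adj)
      (A B : Finset (Fin n)) (kA kB m : ℕ) (col : Fin n → Fin m),
      Rich η c n H A B kA kB ∧ (∀ u v, H.Adj u v → col u ≠ col v) ∧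
        kA ≤ m ∧ m < kA + kB ∧ m ≤ n) :
    ¬ (∀ η c : ℝ, 0 < η → η ≤ 1 / 8 → 0 < c → c ≤ 1 / 8 →
        ∃ ε : ℝ, 0 < ε ∧ ∃ n₀ : ℕ, ∀ n ≥ n₀, ∀ (H : SimpleGraph (Fin n)) [DecidableRel H.Adj]
          (A B : Finset (Fin n)) (kA kB : ℕ), Rich η c n H A B kA kB →
          ∀ C : Circuit (Fin n), C.IsOver monotoneBasis01 →
            (∀ x : Finset (Fin n), x ⊆ A → H.IsNClique kA x →
              C.eval (fun v => decide (v ∈ x)) = true) →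
            (∀ y : Finset (Fin n), y ⊆ B → H.IsNClique kB y →
              C.eval (fun v => decide (v ∈ A ∧ ∀ w ∈ y, H.Adj v w)) = false) →
            (n : ℝ) ^ (ε * Real.logb 2 n) ≤ C.size) := by
  intro hSLB
  obtain ⟨ε, hε, n₀, hn₀⟩ := hSLB η c hη hη' hc hc'
  obtain ⟨N₁, hN₁⟩ := exists_nat_pow_lt_rpow_logb hε 3
  obtain ⟨n, hn, H, inst, A, B, kA, kB, m, col, hR, hcol, hkA, hm, hmn⟩ :=
    hex (max n₀ (max N₁ 4))
  obtain ⟨C, hC, hsize, hpos, hneg⟩ := exists_partite_separator H A kA kB col hcol hkA hm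
  have hlow := hn₀ n (le_of_max_le_left hn) H A B kA kB hR C hC hpos fun y _ hy => hneg y hy
  have hN₁n : N₁ ≤ n := le_trans (le_max_left _ _) (le_of_max_le_right hn)
  have h4 : 4 ≤ n := le_trans (le_max_right _ _) (le_of_max_le_right hn)
  have hcube : (C.size : ℝ) ≤ (n : ℝ) ^ 3 := by
    exact_mod_cast hsize.trans (partite_budget_le_cube hmn h4)
  have hlt := hN₁ n hN₁n
  linarith

end Summit.PneNP.PneNP.Theorems.ResolutionUncertainty.Negative
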